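import Summits.QuantumFields.BalabanUV.T4Continuum.Support.NE7ApeCurvedRepSameTopFourTerm
import HarnessLib

/-!
# NE7ApeCurvedRepSameTopCriticalFourTerm — O2 RE-THREAD, FILE 4: `NE7ApeCurvedRepSameTopCriticalH` ((L3) discharged: the background is tangent-critical, `κ = 0`) RE-CUT on F155
# `NE7ApeCurvedRepSameTopFourTerm`: `(S, hTS, hG)` ↦ the FOUR-TERM letter `h4` + `IsSkewDir A_N` + the displayed data `(σ, Ξ, D_v)`; conclusion gains `+ K_D·D_v + K_Ξ·Ξ`
# (file 86 of the curved (APE), F156)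

Cell `pub-balaban`, rung (B)+1 sub-cell t4, lineage `b2b-balaban-t4-ne7-p1` (CRUX PROVER NE7 #1 = OWNER of row NE7), generation 82; memo
`t4/b2b-balaban-t4-ne7-p1-g82/LOCALISATION-ROAD.md` §2 (O2).  Text-substitution twin of `NE7ApeCurvedRepSameTopCriticalH` (gen 80) over F155.
WHY.  Next link of the road-(B) chain on the four-term root; the successor continues with `…PointedGauge` (where `σ := σ̃` enters) and `…RoadB…` (E′'s divergence clause, the
normal lift's divergence, memo O2's bulk∕face pricing).
WHAT ([folklore]; 0 def, 0 sorry).  **`smallField_of_tanCritical_repSameTop_critBackground_fourTerm`**.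
HONEST FRAMING (page 1): composition over DISPLAYED letters; nothing of Bałaban's asserted; (APE) on curved data NOT proved; NOT ONE-STEP, NOT NE7; spine 0∕9; finite T⁴ rung (B)+1 —
NOT infinite volume, NOT mass gap, NOT `BetaPertH`, NOT Clay.  Continuum YM on T⁴ ⇐ BetaPertH ∧ nine spine estimates (0/9 proved); BetaPertH ⇐ (D1) ∧ (D4) ∧ CAP+tail; G-an2-4
gates asym, D1 and NE2/3/4.
-/

set_option autoImplicit false

open scoped BigOperators Matrix Matrix.Norms.L2Operator
open NormedSpace Finset Set

namespace Summit.QuantumFields.BalabanUV.T4Continuum.NE7ApeCurvedRepSameTopCriticalFourTerm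

open Literature.MathematicalPhysics.QuantumFieldTheory.Balaban1983to89
open B7Prop1Explicit B7Prop2Explicit MatrixLog UnitaryModel
open T4AveragingDeficitWall (Ad IsUnitaryCfg IsSkewDir SmallField vary curlAt dirL1)
open T4AveragingDeficitWallBoundary (IsPeriodicCfg periodBox)
open AveragingDeficitPeriodicCounting (IsPeriodicDir)
open AveragingDeficitTwoLevelPrep (twoLevelSmall)
open AveragingDeficitMultiLevelPrep (cavgIter LevelSmall)
open MinimalActionLevels (perWin)
open BlockAverageVaryHolo (nbRad)
open NE3HessForm (hess dAction)
open NE3TangentCovariantTower (dirIter)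
open NE3EnergyShapes (IsUnitarySite IsPeriodicSite)
open NE3QbarIterCovLiftPrep (cruxC)
open NE3RightInverseSolveLetters (thetaLoc)
open NE3HatInvCurlLetters (curl1C)
open NE7ApeCurvedRepSameTopFourTerm (smallField_of_tanCritical_repSameTop_fourTerm)

open NE3CovariantWeitzenbock (covDiv)
open BlockAveragePushDirGauge (gaugeDir)

noncomputable section

variable {d : ℕ} {n : Type*} [Fintype n] [DecidableEq n]

/-- **(APE) WITH A DATUM FOR A FIBRE-PRESERVING REPRESENTATIVE AT A TANGENT-CRITICAL BACKGROUND, FOUR-TERM SLICE-SOLVER LETTER** —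
`NE7ApeCurvedRepSameTopCriticalH.smallField_of_tanCritical_repSameTop_critBackground` with `(S, hTS, hG)` ↦ (`hNs`, F153's displayed data `σ, Ξ, D_v`, the four-term letter `h4`);
conclusion = the original radius `+ K_D·D_v + K_Ξ·Ξ`. [folklore] -/
theorem smallField_of_tanCritical_repSameTop_critBackground_fourTerm [Nonempty n] (hd : 2 ≤ d) {L N : ℕ} [NeZero N] (hL : 2 ≤ L) (j : ℕ)
    -- the background
    {W : Site d → Fin d → (Matrix n n ℂ)ˣ} {x : ℝ} (hWu : IsUnitaryCfg W) (hWP : IsPeriodicCfg W ((N * L ^ (j + 1) : ℕ) : ℤ))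
    (hx : 0 ≤ x) (hs : LevelSmall d L j x) (hWx : SmallField W x)
    -- the sup radius of the representative and the regime at `x′ = x + 4(e^{α₀} − 1)`
    {α₀ : ℝ} (hα0 : 0 ≤ α₀) (hs' : LevelSmall d L j (x + 4 * (Real.exp α₀ - 1)))
    (hθ : cruxC d L * (((L : ℝ) ^ (j + 1)) ^ 2 * (x + 4 * (Real.exp α₀ - 1))) < 1)
    (hθl : thetaLoc d L * (((L : ℝ) ^ (j + 1)) ^ 2 * (x + 4 * (Real.exp α₀ - 1))) < 1)
    (hε : ((L : ℝ) ^ (j + 1)) ^ 2 * (x + 4 * (Real.exp α₀ - 1)) ≤ 1)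
    -- the field: of the class, tangent-critical
    {U : Site d → Fin d → (Matrix n n ℂ)ˣ} (hUu : IsUnitaryCfg U)
    {xU : ℝ} (hxU : 0 ≤ xU) (hsU : LevelSmall d L j xU) (hUxU : SmallField U xU)
    (hcritU : ∀ Y : Site d → Fin d → Matrix n n ℂ, IsSkewDir Y → IsPeriodicDir Y ((N * L ^ (j + 1) : ℕ) : ℤ) →
      dirIter L (j + 1) U Y = 0 → dAction U Y (perWin d (N * L ^ (j + 1))) = 0)
    -- the DISPLAYED fibre-preserving representative `U^u = W e^{Z}`
    {u : Site d → (Matrix n n ℂ)ˣ} (huU : IsUnitarySite u) (huP : IsPeriodicSite u ((N * L ^ (j + 1) : ℕ) : ℤ))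
    {Z : Site d → Fin d → Matrix n n ℂ} (hZs : IsSkewDir Z) (hZP : IsPeriodicDir Z ((N * L ^ (j + 1) : ℕ) : ℤ))
    (hrep : gaugeAct u U = vary W Z 1) (hZα : ∀ y μ, ‖Z y μ‖ ≤ α₀)
    (hTopZ : cavgIter L (j + 1) (vary W Z 1) = cavgIter L (j + 1) W)
    -- the remaining analytic letters at `W`: (L1) normal lift of `Z`, the gradient member, (L2) slice solver, (L3) tension
    {cN aN KG KX KD KΞ ν : ℝ} (hν : 0 ≤ ν)
    {AN : Site d → Fin d → Matrix n n ℂ} (hNP : IsPeriodicDir AN ((N * L ^ (j + 1) : ℕ) : ℤ)) (hNsup : ∀ y μ, ‖AN y μ‖ ≤ aN)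
    (hNexact : dirIter L (j + 1) W AN = dirIter L (j + 1) W Z)
    (hN7 : ∀ z μ' ν', μ' ≠ ν' → ‖curlAt W AN z μ' ν'‖ ≤ cN)
    (hNorth : ∀ Y : Site d → Fin d → Matrix n n ℂ, IsSkewDir Y → IsPeriodicDir Y ((N * L ^ (j + 1) : ℕ) : ℤ) → dirIter L (j + 1) W Y = 0 →
      |hess W AN Y (perWin d (N * L ^ (j + 1)))| ≤ ν * dirL1 Y (periodBox (d := d) (N * L ^ (j + 1))))
    (hNs : IsSkewDir AN)
    -- the END's known gauge part `σ` and the divergence datum of the re-gauged difference field (memo O2; F153's data, DISPLAYED at this level)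
    {σ : Site d → Matrix n n ℂ} (hσs : ∀ y, σ y ∈ skewAdjoint (Matrix n n ℂ))
    (hσP : ∀ (y : Site d) (i : Fin d), σ (y + ((N * L ^ (j + 1) : ℕ) : ℤ) • e i) = σ y) {Ξ : ℝ} (hσΞ : ∀ y, ‖σ y‖ ≤ Ξ)
    {Dv : ℝ} (hDv : ∀ y, ‖covDiv W (fun z κ => (Z z κ - AN z κ) + gaugeDir W σ z κ) y‖ ≤ Dv)
    {α₁ : ℝ} (hα1 : 0 ≤ α₁) (hZ1 : ∀ (y : Site d) (κ τ : Fin d), ‖Ad (W (y + e κ) τ) (Z (y + e τ) κ) - Z y κ‖ ≤ α₁)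
    -- THE FOUR-TERM SLICE-SOLVER LETTER (F152's shape) on all skew periodic `W`-tangent fields
    (h4 : ∀ X : Site d → Fin d → Matrix n n ℂ, IsSkewDir X →
      IsPeriodicDir X ((N * L ^ (j + 1) : ℕ) : ℤ) → dirIter L (j + 1) W X = 0 → ∀ R : ℝ, (∀ y κ', ‖X y κ'‖ ≤ R) → ∀ g : ℝ, 0 ≤ g →
      (∀ Y : Site d → Fin d → Matrix n n ℂ, IsSkewDir Y → IsPeriodicDir Y ((N * L ^ (j + 1) : ℕ) : ℤ) → dirIter L (j + 1) W Y = 0 →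
        |hess W X Y (perWin d (N * L ^ (j + 1)))| ≤ g * dirL1 Y (periodBox (d := d) (N * L ^ (j + 1)))) →
      ∀ σ' : Site d → Matrix n n ℂ, (∀ y, σ' y ∈ skewAdjoint (Matrix n n ℂ)) →
      (∀ (y : Site d) (i : Fin d), σ' (y + ((N * L ^ (j + 1) : ℕ) : ℤ) • e i) = σ' y) → ∀ Ξ' : ℝ, (∀ y, ‖σ' y‖ ≤ Ξ') →
      ∀ D : ℝ, (∀ y, ‖covDiv W (fun z κ => X z κ + gaugeDir W σ' z κ) y‖ ≤ D) →
      ∀ z μ' ν', μ' ≠ ν' → ‖curlAt W X z μ' ν'‖ ≤ KG * g + KX * R + KD * D + KΞ * Ξ')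
    -- (L3) DISCHARGED: the background is tangent-critical
    (hcritW : ∀ Y : Site d → Fin d → Matrix n n ℂ, IsSkewDir Y → IsPeriodicDir Y ((N * L ^ (j + 1) : ℕ) : ℤ) → dirIter L (j + 1) W Y = 0 →
      dAction W Y (perWin d (N * L ^ (j + 1))) = 0) :
    SmallField U (x + (KG * (
        ((x + 4 * (Real.exp α₀ - 1))
            * ((curl1C d L / (1 - thetaLoc d L * (((L : ℝ) ^ (j + 1)) ^ 2 * (x + 4 * (Real.exp α₀ - 1)))))
                * (((L : ℝ) ^ (j + 1)) ^ d / ((L : ℝ) ^ (j + 1)) ^ 2))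
            * (Real.exp (((L : ℝ) ^ d / L) * ((d : ℝ) * (16 * ((d : ℝ) + 1) * ((d : ℝ) + 4) * (L : ℝ) ^ 2)
                  * (1250 * ((nbRad d L : ℝ) + L) + 8 * ((d : ℝ) * L) + 2 * L)) * (2 / twoLevelSmall d L))
                * ((L : ℝ) / (L : ℝ) ^ d) ^ j
                * (((d : ℝ) * (2 * nbRad d L + 1) ^ d) * ((2 * (d : ℝ) + 4) * (L : ℝ) ^ 2) * (2 * (L : ℝ) ^ j) * (Real.exp α₀ - 1)
                  + (17 / 8 * ((L : ℝ) ^ 2) ^ j * (x + 4 * (Real.exp α₀ - 1)))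
                    * (((d : ℝ) * (2 * nbRad d L + 1) ^ d) * ((2 * (d : ℝ) + 4)
                          * (2 * (2 * L * (nbRad d L : ℝ) + 128 * ((d : ℝ) + 1) * ((d : ℝ) + 4) * (L : ℝ) ^ 2)))
                      + ((d : ℝ) * (2 * nbRad d L + 1) ^ d) * ((2 * (d : ℝ) + 4) * (L : ℝ) ^ 2 * (2 * (nbRad d L : ℝ))
                          + 2 * (8 * (L : ℝ) + (1250 * ((nbRad d L : ℝ) + L) + 8 * (d * L) + 2 * L))
                              * (16 * ((d : ℝ) + 1) * ((d : ℝ) + 4) * (L : ℝ) ^ 2))))))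
        + (Fintype.card (T4AveragingDeficitWall.Plane d) : ℝ)
          * (2 * (240 * (Real.exp α₀ - 1) * α₀ * (2 * α₁ + 24 * α₀ * (Real.exp α₀ - 1) + x) + 8 * α₀ * (2 * α₁ + 24 * α₀ * (Real.exp α₀ - 1))
              + 6 * (Real.exp α₀ - 1) * (2 * α₁ + 24 * (Real.exp α₀ - 1) * α₀)
              + (2 * α₁ + 24 * (Real.exp α₀ - 1) * α₀) * (2 * α₁ + 24 * α₀ * (Real.exp α₀ - 1))
              + 960 * (Real.exp α₀ - 1) * α₀ ^ 2 + 32 * x * α₀ ^ 2)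
            + (64 * α₀ * α₁ + 1024 * x * α₀ ^ 2))
        + ν) + KX * (α₀ + aN) + KD * Dv + KΞ * Ξ + cN + 28 * α₀ ^ 2)) := by
  have hWten : ∀ Y : Site d → Fin d → Matrix n n ℂ, IsSkewDir Y → IsPeriodicDir Y ((N * L ^ (j + 1) : ℕ) : ℤ) → dirIter L (j + 1) W Y = 0 →
      |dAction W Y (perWin d (N * L ^ (j + 1)))| ≤ (0 : ℝ) * dirL1 Y (periodBox (d := d) (N * L ^ (j + 1))) := by
    intro Y hY hYP hYT
    rw [hcritW Y hY hYP hYT, abs_zero, zero_mul]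
  have h := smallField_of_tanCritical_repSameTop_fourTerm hd hL j hWu hWP hx hs hWx hα0 hs' hθ hθl hε hUu hxU hsU hUxU hcritU huU huP hZs hZP hrep hZα hTopZ
    le_rfl hν hNP hNsup hNexact hN7 hNorth hNs hσs hσP hσΞ hDv hα1 hZ1 h4 hWten
  simpa only [add_zero] using h

end

end Summit.QuantumFields.BalabanUV.T4Continuum.NE7ApeCurvedRepSameTopCriticalFourTerm
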